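import Mathlib
import HarnessLib
import Summits.ValiantsHypothesis.ValiantsHypothesis.Theses.MonotoneRestoration
import Literature.Computability.AlgebraicComplexity.ArithCircuit
import Literature.Computability.AlgebraicComplexity.ArithCircuitProofs
import Literature.Computability.AlgebraicComplexity.MonotoneStructure
import Literature.Computability.AlgebraicComplexity.PermanentIrreducible
import Literature.ModelTheory.FiniteModelTheory.CkEquiv
import Summits.ValiantsHypothesis.ValiantsHypothesis.Theorems.MonotoneRestorationMonotoneRestorationQPCosetCount
import Summits.ValiantsHypothesis.ValiantsHypothesis.Theorems.MonotoneRestorationMonotoneRestorationQPSymmetricLB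
import Summits.ValiantsHypothesis.ValiantsHypothesis.Theorems.MonotoneRestorationMonotoneRestorationQPSupportSymmetrisation
import Summits.ValiantsHypothesis.ValiantsHypothesis.Theorems.MonotoneRestorationMonotoneRestorationQPSparseRegime
import Summits.ValiantsHypothesis.ValiantsHypothesis.Theorems.MonotoneRestorationMonotoneRestorationQPBeta
import Literature.Computability.AlgebraicComplexity.SymmetricArithCircuit
import Literature.Computability.AlgebraicComplexity.DawarWilsenach2025Proofs
import Literature.GroupTheory.PermutationGroups.SmallIndexSubgroups
import Summits.ValiantsHypothesis.ValiantsHypothesis.Theorems.MonotoneRestorationQP.Negative.LoadBearing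
import Summits.ValiantsHypothesis.ValiantsHypothesis.Theorems.MonotoneRestorationMonotoneRestorationQPPermSupportCount

/-! TTRL-lite variant V18919 of stmt-ValiantsHypothesis-15886 -/

-- `ValiantsHypothesis.ValiantsHypothesis`: the D-0017 layout repeats the problem name in the path.
set_option linter.dupNamespace false

namespace Summit.ValiantsHypothesis.ValiantsHypothesis.Theorems

open Summit.ValiantsHypothesis.ValiantsHypothesis.Theses.MonotoneRestoration
open Literature.Computability.AlgebraicComplexity

/-- **TTRL-lite variant V18919 of `stub_mulGate_children_extend`** (three-factor kernel of part
(2) of the parent stub, stmt-ValiantsHypothesis-15886). Over `ℝ≥0` nothing cancels: if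
`p * q * r ≠ 0` and every monomial of `p * q * r` extends by a common shift `μ₀` to a monomial of
`f`, then for monomials `m ∈ supp p`, `m' ∈ supp q` some `m + m' + μ` is a monomial of `f` —
take any monomial `m''` of the (nonzero) cofactor `r`; then `m + m' + m'' ∈ supp (p * q * r)` by
`add_mem_support_mul` twice, and `μ := m'' + μ₀` works. In the circuit statement `p, q` are the
two distinct children `h, h'` of a `×` gate and `r` the product of the remaining children
(`Finset.mul_prod_erase` twice). [folklore] -/
theorem stub_mulGate_children_extend_var18919 :
    ∀ (n : ℕ) (p q r f : MvPolynomial (Fin n × Fin n) NNReal), p * q * r ≠ 0 →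
      (∃ μ : (Fin n × Fin n) →₀ ℕ, ∀ m ∈ (p * q * r).support, m + μ ∈ f.support) →
      ∀ m ∈ p.support, ∀ m' ∈ q.support,
        ∃ μ : (Fin n × Fin n) →₀ ℕ, m + m' + μ ∈ f.support := by
  intro n p q r f hpqr hext m hm m' hm'
  obtain ⟨μ₀, hμ₀⟩ := hext
  have hr : r ≠ 0 := by
    rintro rfl
    exact hpqr (mul_zero _)
  obtain ⟨m'', hm''⟩ := MvPolynomial.ne_zero_iff.1 hr
  have hm''s : m'' ∈ r.support := MvPolynomial.mem_support_iff.2 hm''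
  have hprod : m + m' + m'' ∈ (p * q * r).support :=
    add_mem_support_mul (add_mem_support_mul hm hm') hm''s
  refine ⟨m'' + μ₀, ?_⟩
  have := hμ₀ _ hprod
  rwa [add_assoc (m + m') m'' μ₀] at this

end Summit.ValiantsHypothesis.ValiantsHypothesis.Theorems
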